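import Mathlib
import Literature.Claims.NS.Kyritsis2021
import Literature.Analysis.FluidPDE.GavrilovSteadyEulerProofs
import Literature.Analysis.FluidPDE.TaoLocalisation
import Literature.Analysis.FluidPDE.NSLerayHopfSereginEnergyProofs
import HarnessLib

/-!
# Step5PairCone

Topic `Literature/Uncategorized`. Named literature fact(s) relocated by the gate from `Summits/NavierStokesRegularity/NavierStokesRegularity/Theorems/SoloRefuteKyritsis2021.lean`
(accept-time relocation of `[cite]`d propositions written inline in a Summits proposal; human ruling 2026-08-15).
Sources: Kyritsis2021b.

* `Literature.Uncategorized.Step5PairCone`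
-/

namespace Literature.Uncategorized

open Real Set Function MeasureTheory InnerProductSpace
open Literature.Analysis.FluidPDE Literature.Claims.NS.Kyritsis2021
open scoped ContDiff ENNReal RealInnerProductSpace

/-- **Retype R#D of (eq. 35)** (referee's charitable reading «ONE cone per pair, the natural cone of
the geometry»: base radius `R = ‖x₂ − x₁‖`, so `V = (π/3)‖x₂ − x₁‖³`; everything else as in
`Step_5`). Recorded to show that the base-radius freedom is not what the countermodel exploits.
[cite: Kyritsis2021b, eq. (35) p. 20; retype R#D of HOME/claims/Kyritsis2021/RETYPE.md] -/
def Step5PairCone : Prop :=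
  ∀ ν : ℝ, 0 ≤ ν → ∀ T : ℝ, 0 < T →
    ∀ (u : ℝ → EuclideanSpace ℝ (Fin 3) → EuclideanSpace ℝ (Fin 3))
      (p : ℝ → EuclideanSpace ℝ (Fin 3) → ℝ), IsLocalClassSolution ν T u p →
    ∀ t ∈ Ico 0 T, ∀ x₁ x₂ : EuclideanSpace ℝ (Fin 3), x₁ ≠ x₂ →
      ENNReal.ofReal (coneWork p t x₁ x₂ ‖x₂ - x₁‖) ≤ energy u t

end Literature.Uncategorized
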